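import Summits.BirchSwinnertonDyer.Rank1Residual.SmallImageMu.GradedEulerLossCore
import Summits.BirchSwinnertonDyer.Rank1Residual.SmallImageMu.GradedEulerLossEdges
import Summits.BirchSwinnertonDyer.Rank1Residual.SmallImageMu.EulerLossZeroChart
import Literature.NumberTheory.EllipticCurves.Rank1Residual.MuLambdaCarriers
import HarnessLib

set_option autoImplicit false

-- the summit and its single problem are both named `BirchSwinnertonDyer` (registry layout D-0017)
set_option linter.dupNamespace false

/-!
# The lattice of lines on the crux `KatoDivisibilityX9` (stmt-BirchSwinnertonDyer-20547), kernel-checked: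
# «Conj A on X9» ⟹ «fine `μ ≤ 1` on X9» ⟹ S-es-3 (and ⟹ B2); «(A)» ⟹ ES-C4; «`X₀` cyclic» ⟹ B2

Seat `bsd-line-k6-p4` (prover-bsd-line-k6-p4-g2-0; D-0154 KEY (146) row 9; route `OneSidedTwistSqueezeX9`; host cell
`bsd-f3-mu`).  THEOREMS ONLY, sorry-free, tree imports only (no Theses file in the import cone), no definition, no new
named fact, nothing asserted about any curve.  Companion of
`Theorems/OneSidedTwistSqueezeX9KatoDivisibilityX9OfGradedEulerLoss.lean` (p610638, not imported here), which
landed the composition of the lead's line of record `Cruxes/KatoDivisibilityX9/Lines/graded_euler_loss.lean`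
(F1_ζ ∧ DEPTH `SIM.FineExponentLeEulerLossOnClassX9` ∧ WIDTH `SIM.FineMuConcentratedOnClassX9` ⟹ S-es-3
`SIM.FineMuLeEulerLossOnClassX9` ⟹ crux) and the `n = 0`-core slack («`μ(X₀) ≤ 1` at a pair suffices»).
`--supports stmt-BirchSwinnertonDyer-20547`.

This file makes the ORDER of the three candidate obligation sets kernel-visible («LINE (iii)'s stubs are implied by
LINE A's, and by the weakened LINE A′», as theorems rather than sentences):

* §1 `fineMuLeEulerLossOnClassX9_of_fineMu_le_one` — «fine `μ ≤ 1` at every X9 pair» (LINE A's stub weakened, the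
  hypothesis shape of `katoDivisibilityOnClassX9_of_fineMu_le_one`) ⟹ S-es-3, modulo F1_ζ (for the torsion guard,
  read off the §17.13 package) and a modularity witness (S-es-3 carries no newform): at `n ≥ 1` trivially, at
  `n = 0` by the KERNEL core (`one_le_eulerLoss_of_fineMu_ne_zero`'s mechanism: a genuine class `∉ p𝐇¹` forces
  `μ(X₀) = 0`, `SIM.fineExponentLeEulerLossOnClassX9_zero`).  So LINE A′ («`μ ≤ 1`») FACTORS through LINE (iii)'s node.
* §1 `fineMuConcentratedOnClassX9_of_fineMu_le_one` — «fine `μ ≤ 1` on X9» ⟹ B2 (width `≤ 1`), modulo F1_ζ and a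
  modularity witness (guards only): at `n ≥ 1` trivially; at `n = 0` because `μ(p^0 X₀) = μ(X₀)`.
* §2 `fineExponentLeEulerLossOnClassX9_of_fineMuZero_of_guards` — «fine `μ = 0` on X9» (statement (A), the carrier
  `Rank1Residual.FineMuZeroAt`, i.e. LINE A's stub in `μ`-currency) with the finite/torsion guards ⟹ ES-C4 (DEPTH), by
  `μ(p^n X₀) ≤ μ(X₀)`; the sibling «(A) ⟹ B2» is the tree's `SIM.fineMuConcentratedOnClassX9_of_conjAOnClassX9_of_guards`.
  Hence LINE A ⟹ LINE (iii) stub by stub.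
* §3 (the module half of the per-pair WIDTH certificate of MEMO-es §22, «rank ≤ number of generators»):
  `muInvariant_le_muInvariant_pow_smul_top_add_of_cyclic` — `μ(M) ≤ μ(p^n M) + n` for a CYCLIC finitely generated
  torsion `Λ`-module (no structure theory: `M/p^nM` is a quotient of `Λ/(p^n)`); `fineMu_le_of_cyclic` (a cyclic
  `X₀` has width `≤ 1`); `fineMuConcentratedOnClassX9_of_cyclic` («`X₀` cyclic on X9» ⟹ B2, guards from F1_ζ +
  modularity).  The arithmetic half («`X₀` cyclic ⟸ dim H²(G_S(ℚ), E[p]) ≤ 1») is typing ask T-es-5, not in the tree.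

HONEST LABEL: «`μ ≤ 1` on X9», (A) on X9, «`X₀` cyclic on X9», ES-C4 (`n ≥ 1`), B2, S-es-3 are OPEN (each ⟸ item 19630 mod F1_ζ in the
tree; none in print); nothing here decides any of them; PARTITION untouched; beyond-print theorem toward BSD: NO;
BSD is not proved by any of this.

References: K. Kato, Astérisque 295 (2004), Thm. 12.6 (p. 222), §13.8, §17.13 (pp. 279–280) [Kato2004Asterisque];
J. Coates, R. Sujatha, Math. Ann. 331 (2005) §3 [CoatesSujatha2005]; L. Washington, GTM 83 §13.2 [Washington1997];
HOME/MEMO-es.md §14–§25.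
-/

noncomputable section

open scoped Classical MatrixGroups ModularForm NumberField
open CongruenceSubgroup WeierstrassCurve Field
open Literature.NumberTheory.GaloisRepresentations
open Literature.NumberTheory.EllipticCurves Literature.NumberTheory.EllipticCurves.ModularForms
open Literature.NumberTheory.EllipticCurves.Kato2004
open Literature.NumberTheory.EllipticCurves.Kato2004.EulerSystemValues
open Literature.NumberTheory.EllipticCurves.Rank1Residual (FineMuZeroAt)
open Summit.BirchSwinnertonDyer.BirchSwinnertonDyer.Rank1Residual (ClassX9)
open Summit.BirchSwinnertonDyer.Rank1Residual.SmallImageMu (FineMuLeEulerLossOnClassX9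
  FineExponentLeEulerLossOnClassX9 FineMuConcentratedOnClassX9 fineExponentLeEulerLossOnClassX9_zero)
open Module IwasawaAlgebra

namespace Summit.BirchSwinnertonDyer.BirchSwinnertonDyer.Theorems.OneSidedTwistSqueezeX9KatoDivisibilityX9OfGradedEulerLossLattice

/-! ## §0 `μ` of a submodule; `μ` of the top submodule -/

section Mu

variable {p : ℕ} [Fact p.Prime] {M : Type*} [AddCommGroup M] [_root_.Module (IwasawaAlgebra p) M]

/-- `μ(↥⊤) = μ(M)` (the top submodule is linearly equivalent to the module). [folklore] -/
theorem muInvariant_top : muInvariant p (↥(⊤ : Submodule (IwasawaAlgebra p) M)) = muInvariant p M := by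
  let 𝔭 : PrimeSpectrum (IwasawaAlgebra p) := ⟨augIdealP p, isPrime_augIdealP_holds p⟩
  rw [muInvariant_eq_toNat_lengthAt p _ 𝔭 rfl, muInvariant_eq_toNat_lengthAt p M 𝔭 rfl,
    lengthAt_eq_of_linearEquiv (Submodule.topEquiv : (⊤ : Submodule (IwasawaAlgebra p) M) ≃ₗ[_] M) 𝔭]

/-- `μ(N) ≤ μ(M)` for a submodule `N` of a finitely generated torsion `Λ`-module `M` (lengths at `(p)` are
monotone along injections and finite for `M`). [cite: Washington1997, §13.2 (additivity of `μ`)] -/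
theorem muInvariant_submodule_le [Module.Finite (IwasawaAlgebra p) M]
    (hM : Module.IsTorsion (IwasawaAlgebra p) M) (N : Submodule (IwasawaAlgebra p) M) :
    muInvariant p ↥N ≤ muInvariant p M := by
  let 𝔭 : PrimeSpectrum (IwasawaAlgebra p) := ⟨augIdealP p, isPrime_augIdealP_holds p⟩
  have hfin : lengthAt (IwasawaAlgebra p) M 𝔭 ≠ ⊤ := lengthAt_ne_top_of_isTorsion p _ hM 𝔭 rfl
  rw [muInvariant_eq_toNat_lengthAt p _ 𝔭 rfl, muInvariant_eq_toNat_lengthAt p M 𝔭 rfl]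
  exact ENat.toNat_le_toNat (lengthAt_submodule_le N 𝔭) hfin

end Mu

/-! ## §1 «fine `μ ≤ 1` on X9» ⟹ S-es-3 and ⟹ B2 (modulo F1_ζ and a modularity witness, used for guards) -/

section FineMuLeOne

/-- **Guards from print**: at an odd good ordinary pair, F1_ζ and a modularity witness make every dual fine Selmer
datum over cyclotomic data finitely generated AND torsion (the §17.13 package over the pinned `𝐇¹` and the
canonical dual Selmer datum has an exact fine quotient `X ↠ Y.X`; `Kim2025.isTorsion_fine_of_package`).
[cite: Kato2004Asterisque, Thm. 12.4 (1) (p. 221), (14.9.3) (p. 240), §17.13 (p. 279)] -/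
theorem finite_and_isTorsion_fine_of_zeta (hfine : exists_divisibilityInputs_fineQuotient_zeta)
    (hmodP : nonempty_modularParametrizationData) {W : WeierstrassCurve ℚ} [W.IsElliptic]
    [W.IsGloballyMinimal] {p : ℕ} [Fact p.Prime] (hp2 : p ≠ 2) (hord : IsOrdinaryAt W p)
    {κ : ZpExtension ℚ p} {γ : absoluteGaloisGroup ℚ} (hκ : κ.IsCyclotomic) (hγ : κ.IsTopGenerator γ)
    (hγ' : IsCyclotomicVariable p γ) (Y : W.FineSelmerDualData κ γ) :
    Module.Finite (IwasawaAlgebra p) Y.X ∧ Module.IsTorsion (IwasawaAlgebra p) Y.X := by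
  haveI : ContinuousSMul ℤ_[p] (W.tateModule p) := TateModule.continuousSMul_padicInt
  haveI : Module.Free ℤ_[p] (W.tateModule p) := W.module_free_tateModule_holds p
  haveI : Module.Finite ℤ_[p] (W.tateModule p) := W.module_finite_tateModule_holds p
  haveI : NeZero (W.conductorNorm ℤ) := ⟨(W.conductorNorm_pos_holds).ne'⟩
  obtain ⟨Dm⟩ := hmodP W
  obtain ⟨I⟩ := nonempty_iwasawaH1Data_holds W p κ γ hκ hγ
  let D : W.SelmerDualData κ γ := W.selmerDualData κ hγ
  haveI : Module.Finite (IwasawaAlgebra p) D.X :=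
    WeierstrassCurve.SelmerDualData.module_finite_of_isCyclotomic W κ hκ D hγ
  obtain ⟨K, π, hπs, hπ, -⟩ := hfine W p Dm.f κ γ hp2 hord hκ hγ hγ' Dm.isNewformOf I D Y
  exact ⟨Module.Finite.of_surjective π hπs, Kim2025.isTorsion_fine_of_package K π hπs hπ⟩

/-- **«fine `μ ≤ 1` on X9» ⟹ S-es-3** (`SIM.FineMuLeEulerLossOnClassX9`), modulo F1_ζ and a modularity witness
(guards only).  At level `n ≥ 1`: `μ(X₀) ≤ 1 ≤ n`.  At level `n = 0` the hypothesis of S-es-3 is a genuine class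
`∉ p𝐇¹`, and the KERNEL core theorem (`SIM.fineExponentLeEulerLossOnClassX9_zero`) gives `μ(X₀) = 0`.  So the weakened
LINE A («`μ ≤ 1`») factors through the node of LINE (iii). [cite: Kato2004Asterisque, Thm. 12.6 (p. 222), §13.8]
[cite: CoatesSujatha2005, §3 Conjecture A (the case `μ = 0`)] -/
theorem fineMuLeEulerLossOnClassX9_of_fineMu_le_one (hfine : exists_divisibilityInputs_fineQuotient_zeta)
    (hmodP : nonempty_modularParametrizationData)
    (h1 : ∀ (W : WeierstrassCurve ℚ) [W.IsElliptic] [W.IsGloballyMinimal] (p : ℕ) [Fact p.Prime],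
      ClassX9 W p → ∀ (κ : ZpExtension ℚ p) (γ : absoluteGaloisGroup ℚ), κ.IsCyclotomic →
      κ.IsTopGenerator γ → IsCyclotomicVariable p γ → ∀ Y : W.FineSelmerDualData κ γ,
        Module.Finite (IwasawaAlgebra p) Y.X → Module.IsTorsion (IwasawaAlgebra p) Y.X →
        muInvariant p Y.X ≤ 1) :
    FineMuLeEulerLossOnClassX9 := by
  intro W _ _ p _ _ _ _ κ γ I n hX9 hκ hγ hγ' hs Y
  obtain ⟨-, h5, hgood, hap, hirr, hns⟩ := id hX9
  have hp2 : p ≠ 2 := by omega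
  obtain ⟨hYf, hYt⟩ := finite_and_isTorsion_fine_of_zeta hfine hmodP hp2 ⟨hgood, hap⟩ hκ hγ hγ' Y
  have hμ1 : muInvariant p Y.X ≤ 1 := h1 W p hX9 κ γ hκ hγ hγ' Y hYf hYt
  rcases Nat.eq_zero_or_pos n with rfl | hn
  · -- `n = 0`: the kernel core kills `μ(X₀)` outright
    have h0 := fineExponentLeEulerLossOnClassX9_zero W p κ γ I hX9 hκ hγ hγ' hs Y
    rw [pow_zero, Ideal.one_eq_top, Submodule.top_smul, muInvariant_top] at h0
    exact h0.le
  · omega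

/-- **«fine `μ ≤ 1` on X9» ⟹ B2** (`SIM.FineMuConcentratedOnClassX9`, width `≤ 1`), modulo F1_ζ and a modularity
witness (guards only): for `n ≥ 1` trivially, for `n = 0` because `μ(p^0 X₀) = μ(X₀)`.
[cite: CoatesSujatha2005, §3 Conjecture A] [cite: Washington1997, §13.2] -/
theorem fineMuConcentratedOnClassX9_of_fineMu_le_one (hfine : exists_divisibilityInputs_fineQuotient_zeta)
    (hmodP : nonempty_modularParametrizationData)
    (h1 : ∀ (W : WeierstrassCurve ℚ) [W.IsElliptic] [W.IsGloballyMinimal] (p : ℕ) [Fact p.Prime],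
      ClassX9 W p → ∀ (κ : ZpExtension ℚ p) (γ : absoluteGaloisGroup ℚ), κ.IsCyclotomic →
      κ.IsTopGenerator γ → IsCyclotomicVariable p γ → ∀ Y : W.FineSelmerDualData κ γ,
        Module.Finite (IwasawaAlgebra p) Y.X → Module.IsTorsion (IwasawaAlgebra p) Y.X →
        muInvariant p Y.X ≤ 1) :
    FineMuConcentratedOnClassX9 := by
  intro W _ _ p _ κ γ hX9 hκ hγ hγ' Y n hn0
  obtain ⟨-, h5, hgood, hap, hirr, hns⟩ := id hX9
  have hp2 : p ≠ 2 := by omega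
  obtain ⟨hYf, hYt⟩ := finite_and_isTorsion_fine_of_zeta hfine hmodP hp2 ⟨hgood, hap⟩ hκ hγ hγ' Y
  have hμ1 : muInvariant p Y.X ≤ 1 := h1 W p hX9 κ γ hκ hγ hγ' Y hYf hYt
  rcases Nat.eq_zero_or_pos n with rfl | hn
  · rw [pow_zero, Ideal.one_eq_top, Submodule.top_smul, muInvariant_top] at hn0
    exact hn0.le
  · omega

end FineMuLeOne

/-! ## §2 «fine `μ = 0` on X9» (statement (A), guarded) ⟹ ES-C4 (DEPTH): LINE A ⟹ LINE (iii) stub by stub -/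

section ConjA

/-- **Statement (A) on X9 with its guards ⟹ ES-C4** (`SIM.FineExponentLeEulerLossOnClassX9`): for a finitely
generated torsion `X₀` with `μ(X₀) = 0`, `μ(p^n X₀) ≤ μ(X₀) = 0` for every `n` (no Euler-system input used).  The
guards `hY` are those of the tree's sibling `SIM.fineMuConcentratedOnClassX9_of_conjAOnClassX9_of_guards` («(A) ⟹
B2»); together: LINE A's stub implies BOTH stubs of LINE (iii). [cite: CoatesSujatha2005, §3 Conjecture A]
[cite: Washington1997, §13.2] -/
theorem fineExponentLeEulerLossOnClassX9_of_fineMuZero_of_guards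
    (hA : ∀ (W : WeierstrassCurve ℚ) [W.IsElliptic] [W.IsGloballyMinimal] (p : ℕ) [Fact p.Prime],
      ClassX9 W p → FineMuZeroAt W p)
    (hY : ∀ (W : WeierstrassCurve ℚ) [W.IsElliptic] [W.IsGloballyMinimal] (p : ℕ) [Fact p.Prime]
      (κ : ZpExtension ℚ p) (γ : absoluteGaloisGroup ℚ), ClassX9 W p → κ.IsCyclotomic →
      κ.IsTopGenerator γ → IsCyclotomicVariable p γ → ∀ Y : W.FineSelmerDualData κ γ,
        Module.Finite (IwasawaAlgebra p) Y.X ∧ Module.IsTorsion (IwasawaAlgebra p) Y.X) :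
    FineExponentLeEulerLossOnClassX9 := by
  intro W _ _ p _ _ _ _ κ γ I n hX9 hκ hγ hγ' _hs Y
  obtain ⟨hYf, hYt⟩ := hY W p κ γ hX9 hκ hγ hγ' Y
  have h0 : muInvariant p Y.X = 0 := hA W p hX9 κ γ hκ hγ hγ' Y hYf hYt
  haveI := hYf
  have hle := muInvariant_submodule_le hYt ((augIdealP p ^ n) • (⊤ : Submodule (IwasawaAlgebra p) Y.X))
  omega

end ConjA

/-! ## §3 The kernel half of the per-pair WIDTH certificate: a CYCLIC `X₀` has at most one `μ`-divisor -/

section Cyclic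

variable {p : ℕ} [Fact p.Prime] {M : Type*} [AddCommGroup M] [_root_.Module (IwasawaAlgebra p) M]

/-- **`μ(M) ≤ μ(p^n M) + n` for a CYCLIC finitely generated torsion `Λ`-module `M`**: `ℓ(M) = ℓ(p^nM) + ℓ(M/p^nM)`
and `M/p^nM` is a quotient of `Λ/(p^n)`, of `ℓ_(p) = n`.  (For `M = Λ/I` with `I_(p) = (p^v)`: `μ(M) = v`,
`μ(p^nM) = max(v − n, 0)`.)  No structure theory used. [cite: Washington1997, §13.2] [cite: Lang1990, Ch. 5 §1 Thm. 1.2 (i)] -/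
theorem muInvariant_le_muInvariant_pow_smul_top_add_of_cyclic [Module.Finite (IwasawaAlgebra p) M]
    (hM : Module.IsTorsion (IwasawaAlgebra p) M) {x : M} (hx : Submodule.span (IwasawaAlgebra p) {x} = ⊤)
    (n : ℕ) :
    muInvariant p M ≤ muInvariant p ↥((augIdealP p ^ n) • (⊤ : Submodule (IwasawaAlgebra p) M)) + n := by
  let 𝔭 : PrimeSpectrum (IwasawaAlgebra p) := ⟨augIdealP p, isPrime_augIdealP_holds p⟩
  have h1ht : 𝔭.asIdeal.height = 1 := height_augIdealP_holds p
  set N : Submodule (IwasawaAlgebra p) M := (augIdealP p ^ n) • ⊤ with hN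
  -- `Λ/(p^n) ↠ M/p^nM` along `r ↦ r • x`
  have hpn : (augIdealP p ^ n : Ideal (IwasawaAlgebra p)) =
      Ideal.span {(PowerSeries.C ((p : ℤ_[p]) ^ n) : IwasawaAlgebra p)} := by
    rw [augIdealP, Ideal.span_singleton_pow, map_pow]
  let f : IwasawaAlgebra p →ₗ[IwasawaAlgebra p] M ⧸ N :=
    N.mkQ ∘ₗ LinearMap.toSpanSingleton (IwasawaAlgebra p) M x
  have hker : Ideal.span {(PowerSeries.C ((p : ℤ_[p]) ^ n) : IwasawaAlgebra p)} ≤ LinearMap.ker f := by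
    rw [Ideal.span_singleton_le_iff_mem, LinearMap.mem_ker]
    change N.mkQ ((PowerSeries.C ((p : ℤ_[p]) ^ n) : IwasawaAlgebra p) • x) = 0
    rw [Submodule.mkQ_apply, Submodule.Quotient.mk_eq_zero, hN, hpn]
    exact Submodule.smul_mem_smul (Ideal.mem_span_singleton_self _) Submodule.mem_top
  let fbar := (Ideal.span {(PowerSeries.C ((p : ℤ_[p]) ^ n) : IwasawaAlgebra p)}).liftQ f hker
  have hsurj : Function.Surjective fbar := by
    intro y
    obtain ⟨m, rfl⟩ := Submodule.mkQ_surjective N y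
    have hm : m ∈ Submodule.span (IwasawaAlgebra p) {x} := by rw [hx]; exact Submodule.mem_top
    obtain ⟨r, rfl⟩ := Submodule.mem_span_singleton.mp hm
    exact ⟨Submodule.Quotient.mk r, rfl⟩
  have hquot : lengthAt (IwasawaAlgebra p) (M ⧸ N) 𝔭 ≤ n := by
    refine (lengthAt_le_of_surjective fbar hsurj 𝔭).trans ?_
    rw [lengthAt_quotient_C_pow n 𝔭 h1ht,
      if_pos (show PowerSeries.C (p : ℤ_[p]) ∈ 𝔭.asIdeal from Ideal.subset_span rfl)]
    simp
  -- `ℓ(M) = ℓ(N) + ℓ(M/N)`, all finite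
  have hadd := lengthAt_eq_add_quotient N 𝔭
  have hMfin : lengthAt (IwasawaAlgebra p) M 𝔭 ≠ ⊤ := lengthAt_ne_top_of_isTorsion p _ hM 𝔭 rfl
  have hNfin : lengthAt (IwasawaAlgebra p) ↥N 𝔭 ≠ ⊤ :=
    ne_top_of_le_ne_top hMfin (lengthAt_submodule_le N 𝔭)
  have hQfin : lengthAt (IwasawaAlgebra p) (M ⧸ N) 𝔭 ≠ ⊤ :=
    ne_top_of_le_ne_top hMfin (lengthAt_quotient_le N 𝔭)
  obtain ⟨a, ha⟩ := ENat.ne_top_iff_exists.mp hNfin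
  obtain ⟨b, hb⟩ := ENat.ne_top_iff_exists.mp hQfin
  rw [muInvariant_eq_toNat_lengthAt p M 𝔭 rfl, muInvariant_eq_toNat_lengthAt p (↥N) 𝔭 rfl, hadd, ← ha, ← hb]
  rw [← hb] at hquot
  have hb' : b ≤ n := by exact_mod_cast hquot
  have : ((a : ℕ∞) + (b : ℕ∞)).toNat = a + b := by norm_cast
  rw [this, ENat.toNat_coe]
  omega

/-- **A cyclic dual fine Selmer datum has width `≤ 1`** (the module half of the per-pair B2 certificate of
MEMO-es §22: `rank ≤ number of generators`): if `Y.X` is finitely generated torsion and generated by one element,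
then `μ(p^n Y.X) = 0 ⟹ μ(Y.X) ≤ n` for every `n`.  The arithmetic half («`X₀` cyclic ⟸ dim H²(G_S(ℚ), E[p]) ≤ 1»,
Shapiro + Nakayama) is not typable in the tree today (no `H²(G_S(ℚ), E[p])` object; typing ask T-es-5).
[cite: Washington1997, §13.2] -/
theorem fineMu_le_of_cyclic {K : Type} [Field K] [NumberField K] {W : WeierstrassCurve K} [W.IsElliptic]
    {κ : ZpExtension K p} {γ : absoluteGaloisGroup K} (Y : W.FineSelmerDualData κ γ)
    [Module.Finite (IwasawaAlgebra p) Y.X] (hYt : Module.IsTorsion (IwasawaAlgebra p) Y.X)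
    {x : Y.X} (hx : Submodule.span (IwasawaAlgebra p) {x} = ⊤) (n : ℕ)
    (h0 : muInvariant p ↥((augIdealP p ^ n) • (⊤ : Submodule (IwasawaAlgebra p) Y.X)) = 0) :
    muInvariant p Y.X ≤ n := by
  have h := muInvariant_le_muInvariant_pow_smul_top_add_of_cyclic hYt hx n
  omega

/-- **«`X₀` cyclic at every X9 pair» ⟹ B2** (`SIM.FineMuConcentratedOnClassX9`), modulo F1_ζ and a modularity
witness (guards only) — the class-level form of the module half of the width certificate.  («`X₀` cyclic on X9» is
itself OPEN and is NOT implied by Conjecture A; recorded only to make the certificate's shape kernel-visible.)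
[cite: Washington1997, §13.2] -/
theorem fineMuConcentratedOnClassX9_of_cyclic (hfine : exists_divisibilityInputs_fineQuotient_zeta)
    (hmodP : nonempty_modularParametrizationData)
    (hcyc : ∀ (W : WeierstrassCurve ℚ) [W.IsElliptic] [W.IsGloballyMinimal] (p : ℕ) [Fact p.Prime],
      ClassX9 W p → ∀ (κ : ZpExtension ℚ p) (γ : absoluteGaloisGroup ℚ), κ.IsCyclotomic →
      κ.IsTopGenerator γ → IsCyclotomicVariable p γ → ∀ Y : W.FineSelmerDualData κ γ,
        ∃ x : Y.X, Submodule.span (IwasawaAlgebra p) {x} = ⊤) :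
    FineMuConcentratedOnClassX9 := by
  intro W _ _ p _ κ γ hX9 hκ hγ hγ' Y n hn0
  obtain ⟨-, h5, hgood, hap, hirr, hns⟩ := id hX9
  have hp2 : p ≠ 2 := by omega
  obtain ⟨hYf, hYt⟩ := finite_and_isTorsion_fine_of_zeta hfine hmodP hp2 ⟨hgood, hap⟩ hκ hγ hγ' Y
  haveI := hYf
  obtain ⟨x, hx⟩ := hcyc W p hX9 κ γ hκ hγ hγ' Y
  exact fineMu_le_of_cyclic Y hYt hx n hn0

end Cyclic


end Summit.BirchSwinnertonDyer.BirchSwinnertonDyer.Theorems.OneSidedTwistSqueezeX9KatoDivisibilityX9OfGradedEulerLossLattice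

end
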